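import Summits.Schanuel.Schanuel.Theorems.SoloInformedRoyDegreeRange
import Summits.Schanuel.Schanuel.Statement

/-!
# Roy's Conjecture 2 in axis–degree form, and its logical anatomy

Roy 2001 proves, rank by rank, `Conjecture 2 (rank l) ⟺ Schanuel (rank l)` (`Roy2001_iff_holds`).
Direction 1° of his §5 evaluates the hypothesis of Conjecture 2 only at the AXIS translates
`m = m·e_j`, where it is condition (b) of Theorem 1 for the pair `(y_j, α_j)`; and by the
degree-range criterion (`royConditionA_of_royConditionB_deg`, file `SoloInformedRoyDegreeRange`)
condition (b) is already decisive with translates `m ≤ N^{t₁}`.  This file records the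
resulting anatomy of Roy's criterion as kernel facts:

* `le_trdeg_of_forall_royConditionA` — Roy §5, 1° (second half) isolated: Schanuel for rank `l`,
  `y` linearly independent and `α_j^{d_j} = e^{d_j y_j}` (`d_j ≥ 1`) for all `j` give
  `trdeg ℚ(y, α) ≥ l` (transcribed from the tree's `royCriterion_of_schanuelRank`).
* `schanuelRank_iff_forall_royConditionA` — Schanuel (rank `l`) is equivalent to its
  "torsion-twisted" form: `trdeg ℚ(y, α) ≥ l` whenever `y` is linearly independent and every
  pair `(y_j, α_j)` satisfies (a).
* `schanuelRank_iff_axis_degree_criterion` — **axis–degree form of Conjecture 2**: Schanuel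
  (rank `l`) is equivalent to the criterion whose hypothesis is imposed on each axis pair
  `(y_j, α_j)` SEPARATELY (one polynomial sequence per axis allowed), with translates only up to
  `N^{t₁}`, and with the parameter conditions `0 < t₁`, `max{1, t₀, 2t₁} < s₀`, `2t₁ < u` only
  (no `s₁`, no upper bound on `u`).  Roy's form (one polynomial, all translates in the cube
  `[0, N^{s₁}]^l`, admissible window) sits between this form and Schanuel, so all three are
  equivalent.
* `schanuel_iff_forall_axis_degree_criterion` — the same for the summit statement `Schanuel`.

Reading.  Logically, Roy's criterion factors as [rank-one rigidity: (b) on an axis forces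
`α_j^d = e^{d y_j}` — a THEOREM, decisive already on the translates `m ≤ deg_{X₁}`] followed
by
[Schanuel's conjecture in torsion-twisted form].  The mixed translates of Conjecture 2 and the
translates between `N^{t₁}` and `N^{s₁}` carry no additional logical leverage; whatever proof
leverage they carry would have to prove Schanuel from hypotheses that are satisfiable exactly
when each `α_j` is `e^{y_j}` up to torsion.

References: D. Roy, *An arithmetic criterion for the values of the exponential function*, Acta
Arith. 97 (2001) 183–194, Thm. 1, §5 [Roy2001].
-/

noncomputable section

open MvPolynomial Filter Complex
open Literature.NumberTheory.Transcendental

namespace Summit.Schanuel.Schanuel.Theorems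

/-- **Roy 2001, §5, 1° (second half), isolated.** Schanuel's conjecture for rank `l`,
linear independence of `y` over `ℚ` and `α_j^{d_j} = e^{d_j y_j}` with `d_j ≥ 1` for every `j`
give `trdeg_ℚ ℚ(y, α) ≥ l`: with `D = ∏ d_j`, `D y` is linearly independent,
`e^{D y_j} = α_j^D`, so `ℚ(Dy, e^{Dy}) ⊆ ℚ(y, α)`. Transcribed from the tree's
`royCriterion_of_schanuelRank`. [cite: Roy2001, §5 (1°)] -/
theorem le_trdeg_of_forall_royConditionA {l : ℕ} (hS : SchanuelRank l) {y α : Fin l → ℂ}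
    (hy : LinearIndependent ℚ y) (hd : ∀ j, RoyConditionA (y j) (α j)) :
    (l : Cardinal) ≤ Algebra.trdeg ℚ
      ↥(IntermediateField.adjoin ℚ (Set.range y ∪ Set.range α)) := by
  choose d hd1 hd2 using hd
  set D : ℕ := ∏ j, d j with hD
  have hD0 : 0 < D := Finset.prod_pos fun j _ => hd1 j
  have hαD : ∀ j, α j ^ D = cexp (D * y j) := by
    intro j
    obtain ⟨e, he⟩ : d j ∣ D := Finset.dvd_prod_of_mem _ (Finset.mem_univ j)
    rw [he, pow_mul, hd2 j, ← Complex.exp_nat_mul]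
    push_cast; ring_nf
  set y' : Fin l → ℂ := fun j => (D : ℂ) * y j with hy'_def
  have hy' : LinearIndependent ℚ y' := by
    have hDq : (D : ℚ) ≠ 0 := by exact_mod_cast hD0.ne'
    have := hy.units_smul (fun _ => Units.mk0 (D : ℚ) hDq)
    convert this using 1
    ext j
    simp [hy'_def, Units.smul_def, Rat.smul_def]
  have hle : IntermediateField.adjoin ℚ (Set.range y' ∪ Set.range (cexp ∘ y')) ≤
      IntermediateField.adjoin ℚ (Set.range y ∪ Set.range α) := by
    refine IntermediateField.adjoin_le_iff.mpr ?_
    rintro x (⟨j, rfl⟩ | ⟨j, rfl⟩)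
    · exact mul_mem (natCast_mem _ D)
        (IntermediateField.subset_adjoin _ _ (Or.inl ⟨j, rfl⟩))
    · change cexp ((D : ℂ) * y j) ∈ _
      rw [← hαD j]
      exact pow_mem (IntermediateField.subset_adjoin ℚ (Set.range y ∪ Set.range α)
        (Or.inr ⟨j, rfl⟩)) D
  calc (l : Cardinal)
      ≤ Algebra.trdeg ℚ
          ↥(IntermediateField.adjoin ℚ (Set.range y' ∪ Set.range (cexp ∘ y'))) := hS y' hy'
    _ ≤ Algebra.trdeg ℚ ↥(IntermediateField.adjoin ℚ (Set.range y ∪ Set.range α)) :=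
        trdeg_le_of_injective (IntermediateField.inclusion hle)
          (IntermediateField.inclusion_injective hle)

/-- **Schanuel (rank `l`) in torsion-twisted form.** `SchanuelRank l` is equivalent to: for
`y` linearly independent over `ℚ` and `α` with `α_j^{d_j} = e^{d_j y_j}` (`d_j ≥ 1`) for all
`j`, `trdeg_ℚ ℚ(y, α) ≥ l`. (`←`: take `α = e^y`, `d_j = 1`.) [cite: Roy2001, §5 (1°)] -/
theorem schanuelRank_iff_forall_royConditionA (l : ℕ) :
    SchanuelRank l ↔
      ∀ (y α : Fin l → ℂ), LinearIndependent ℚ y → (∀ j, RoyConditionA (y j) (α j)) →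
        (l : Cardinal) ≤ Algebra.trdeg ℚ
          ↥(IntermediateField.adjoin ℚ (Set.range y ∪ Set.range α)) := by
  refine ⟨fun hS y α hy hd => le_trdeg_of_forall_royConditionA hS hy hd, fun h y hy => ?_⟩
  exact h y (cexp ∘ y) hy fun j => ⟨1, le_rfl, by simp⟩

/-- **Axis–degree form of Roy's Conjecture 2.** `SchanuelRank l` is equivalent to: for
`y ∈ ℂ^l` linearly independent over `ℚ`, `α ∈ (ℂˣ)^l` and parameters with `0 < t₁`,
`max{1, t₀, 2t₁} < s₀`, `2t₁ < u` (no `s₁`, no upper bound on `u`), if EACH axis pair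
`(y_j, α_j)` satisfies condition (b) with translates `m ≤ N^{t₁}` (a polynomial sequence per
axis allowed), then `trdeg_ℚ ℚ(y, α) ≥ l`. (`→`: degree-range criterion per axis +
`le_trdeg_of_forall_royConditionA`; `←`: this criterion implies Roy's `RoyCriterion l`, which
implies `SchanuelRank l` by `Roy2001_iff_holds`.) [cite: Roy2001, Conjecture 2, Thm. 1, §5] -/
theorem schanuelRank_iff_axis_degree_criterion (l : ℕ) :
    SchanuelRank l ↔
      ∀ (y α : Fin l → ℂ), LinearIndependent ℚ y → (∀ j, α j ≠ 0) →
        ∀ (s₀ t₀ t₁ u : ℝ), 0 < t₁ → 1 < s₀ → t₀ < s₀ → 2 * t₁ < s₀ → 2 * t₁ < u →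
          (∀ j, RoyConditionB (y j) (α j) s₀ t₁ t₀ t₁ u) →
            (l : Cardinal) ≤ Algebra.trdeg ℚ
              ↥(IntermediateField.adjoin ℚ (Set.range y ∪ Set.range α)) := by
  constructor
  · intro hS y α hy hα s₀ t₀ t₁ u ht₁ h1s₀ ht₀s₀ h2t₁s₀ h2t₁u hb
    exact le_trdeg_of_forall_royConditionA hS hy fun j =>
      royConditionA_of_royConditionB_deg (hα j) (by linarith) ht₁ (by linarith) h1s₀
        ht₀s₀ h2t₁s₀ h2t₁u (hb j)
  · intro h
    refine (Roy2001_iff_holds l).mp ?_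
    intro y α hy hα s₀ s₁ t₀ t₁ u hadm hhyp
    obtain ⟨⟨hs₀, hs₁, ht₀, ht₁, hu⟩, ⟨h1s₀, ht₀s₀, h2t₁s₀, h1s₁, ht₀s₁, h2t₁s₁⟩,
      ⟨hs₀u, hst, hu2⟩⟩ := royAdmissible_iff.mp hadm
    refine h y α hy hα s₀ t₀ t₁ u ht₁ h1s₀ ht₀s₀ h2t₁s₀ (by linarith) fun j => ?_
    exact royConditionB_mono (y j) (α j) (by linarith)
      (royConditionB_of_royHypothesis hhyp j)

/-- **Schanuel's conjecture ⟺ the axis–degree criterion in every rank.** (`Schanuel` is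
`∀ l, SchanuelRank l` definitionally.) [cite: Roy2001, Conjecture 2, Thm. 1, §5] -/
theorem schanuel_iff_forall_axis_degree_criterion :
    Schanuel ↔
      ∀ l : ℕ, ∀ (y α : Fin l → ℂ), LinearIndependent ℚ y → (∀ j, α j ≠ 0) →
        ∀ (s₀ t₀ t₁ u : ℝ), 0 < t₁ → 1 < s₀ → t₀ < s₀ → 2 * t₁ < s₀ → 2 * t₁ < u →
          (∀ j, RoyConditionB (y j) (α j) s₀ t₁ t₀ t₁ u) →
            (l : Cardinal) ≤ Algebra.trdeg ℚ
              ↥(IntermediateField.adjoin ℚ (Set.range y ∪ Set.range α)) := by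
  have h0 : Schanuel ↔ ∀ l, SchanuelRank l := Iff.rfl
  rw [h0]
  exact forall_congr' schanuelRank_iff_axis_degree_criterion

end Summit.Schanuel.Schanuel.Theorems

end
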